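import Literature.IUT.HodgeTheaters.Cor53iArithHBOfBrigidKummer
import Literature.IUT.HodgeTheaters.Cor53iFcircHdescNotAtNormalClosureCarrier
import Literature.IUT.HodgeTheaters.Cor53iFcircLiftsAllAtOpenEmbedding
import Literature.AnabelianGeometry.AbsoluteAnabelian.NeukirchUchidaTheorem
import HarnessLib

/-!
# [IUTchI] Cor 5.3 (i) at `⊛` and at `⊚`: the FACT binder `(hNU : NeukirchUchida F)` DISCHARGED BY NAME — the apex headlines of the
# slot re-issued FACT-FREE over the tree's THEOREM `neukirchUchida_holds`

S. Mochizuki, *Inter-universal Teichmüller theory I*, kurims manuscript (May 2020), §5 Cor 5.3 (i) p. 144 l. 2–11 («the natural map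
`Isom(¹ℱ^⊛, ²ℱ^⊛) → Isom(Base(¹ℱ^⊛), Base(²ℱ^⊛))` (resp. `⊚`) … is bijective»), proof l. 24–33; Example 5.1 (i) p. 123, (iii) pp. 125–126,
(v) pp. 127–129 ([IUTchI] Cor 5.3 (i) p.144) [claim: Mochizuki2012, status: disputed] (D-0012 claim key; PROOFS ONLY over landed files;
nothing of the series is asserted; no side taken on [IUTchIII] Cor. 3.12).  CLASSICAL input: the Neukirch–Uchida theorem [NSW] Thm (12.2.1)
= [AbsAnab] Thm 1.1.3 [cite: NeukirchSchmidtWingberg2008, Thm (12.2.1)] [cite: MochizukiAbsAnab2004, Thm 1.1.3 p.6] — in the tree the typed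
Prop `Literature.NumberTheory.GaloisRepresentations.NeukirchUchida F` (abc-iut-w5-d201, p437013; its print-faithfulness is that file's statement
audit) AND, since 2026-08-26T17:34Z, a KERNEL THEOREM with zero named-fact hypotheses: ★ p458975
`Literature.AnabelianGeometry.AbsoluteAnabelian.neukirchUchida_holds (F) : NeukirchUchida F` (abc-iut-L4-d2, `AbsoluteAnabelian/NeukirchUchidaTheorem.lean`,
apex of plan/L4/SUBDAG-NeukirchUchida.md, GAP row G-L4d2g4-1; axioms `propext · Classical.choice · Quot.sound`).

PROOF-ONLY glue (cell abc-iut, seat abc-iut-L5-t11 gen 23, row «NU-DISCHARGE@COR53I», abc-iut-L5-lead RULINGS #243 (2); 0 def · 0 instance ·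
0 abbrev · 0 notation · no Prop fact; every proof ONE LINE = the landed `…_of_neukirchUchida` apex applied to `neukirchUchida_holds F`; the
interior lemmas of the nine Cor 5.3 (i) files are NOT re-issued).  FACT {`NeukirchUchida F`} discharged by ★ `neukirchUchida_holds`
(abc-iut-L4-d2 p458975) in the APEX HEADLINES of the slot:
* §1 `⊛` at the genuine arithmetic model `ℱ^⊛(†𝒟^⊚)`: `GlobalDivisorData.liftsAll_modelBase_arith` (= `hlift⊛`, abc-iut-w4-d109 ★ p525660) and
  **`Cor53.arith_descendBijective`** (abc-iut-L5-t11 ★ p539304 knit) — «bijective» with FACT ∅ · LAW ∅ · SIDE ∅;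
* §2 `⊚` at EVERY open-embedding push carrier `ι : H ↪ G_F`: **`GlobalFrobenioid.liftsAll_fcircBase_arith_of_openEmbedding`** (= `hlift⊚`) and
  **`Cor53.fcirc_descendBijective_of_openEmbedding`** (abc-iut-L5-t11 ★ p562181) — «bijective» with displayed binders = the carrier data
  `{hc, ho, hinj}` ONLY: FACT ∅ · LAW ∅ · SIDE ∅;
* §3 the descent-route law: **`Cor53.forall_openEmbedding_hdesc_iff_normal`** (abc-iut-L5-t4 ★ p559943) — `hdesc⊚` at every open-embedding
  carrier `⟺ F/ℚ` normal, now an UNCONDITIONAL `iff`.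
HONEST LABEL: OUR stand-in carriers (`ℬ(G_F)⁰`; push along `ι` of `ℬ(H)⁰` — print's `ι` is `π₁(C_K) ↪ π₁(C_{F_mod})` with `F`-coricity,
Ex 5.1 (i)) and OUR lift / descent routes; a kernel discharge of OUR typed Prop `NeukirchUchida F`, whose kernel proof is abc-iut-L4's and is
CITED BY NAME (not re-proved, not re-costumed); typed ≠ inhabited ≠ proved-in-print; no side on [IUTchIII] Cor 3.12; not an abc claim.
-/

noncomputable section

namespace Literature.IUT.HodgeTheaters

open CategoryTheory Function Literature.AlgebraicGeometry.Frobenioids Literature.AnabelianGeometry.SemiGraphs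
open Literature.AlgebraicGeometry.Frobenioids.QuasiTemperoid Literature.NumberTheory.GaloisRepresentations
open Literature.AnabelianGeometry.AbsoluteAnabelian (neukirchUchida_holds)

/-! ### §1. `⊛` at the GENUINE arithmetic model `ℱ^⊛(†𝒟^⊚) → ℬ(G_F)⁰`: `hlift⊛` and «bijective», FACT ∅ · LAW ∅ · SIDE ∅ -/

namespace GlobalDivisorData

variable (F : Type) [Field F] [NumberField F]

/-- **`hlift⊛` UNCONDITIONAL**: under every self-equivalence `Θ` of `†𝒟^⊛ = ℬ(G_F)⁰` lies a self-equivalence `Ψ` of `ℱ^⊛(†𝒟^⊚)` —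
abc-iut-w4-d109's ★ `liftsAll_modelBase_arith_of_neukirchUchida` with FACT {NU} discharged by ★ `neukirchUchida_holds` (abc-iut-L4-d2 p458975).
OUR stand-in carriers; no side on [IUTchIII] Cor 3.12; not an abc claim. ([IUTchI] Cor 5.3 (i) p.144)
[cite: NeukirchSchmidtWingberg2008, Thm (12.2.1)] [claim: Mochizuki2012, status: disputed] -/
theorem liftsAll_modelBase_arith :
    ∀ Θ : BaseCat (absGalGrp F) ≌ BaseCat (absGalGrp F),
      ∃ Ψ : (arith F).ModelGlobalFrobenioid ≌ (arith F).ModelGlobalFrobenioid,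
        Nonempty (CatIsomorphism.LiesUnder (arith F).modelBase (arith F).modelBase Ψ Θ) :=
  liftsAll_modelBase_arith_of_neukirchUchida F (neukirchUchida_holds F)

end GlobalDivisorData

namespace Cor53

variable (F : Type) [Field F] [NumberField F]

/-- **[IUTchI] Cor 5.3 (i) AS PRINTED («bijective») at `ℱ^⊛(†𝒟^⊚) → ℬ(G_F)⁰` — FACT ∅ · LAW ∅ · SIDE ∅**: injectivity = abc-iut-L5-t11's ★
`arith_descend_injective` (ratio rigidity of the arithmetic units, [FrdI] Cor 4.11 (ii)); surjectivity = `hlift⊛`; abc-iut-L5-t11's ★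
`arith_descendBijective_of_neukirchUchida` (p539304) with FACT {NU} discharged by ★ `neukirchUchida_holds` (abc-iut-L4-d2 p458975).
OUR model of `ℱ^⊛(†𝒟^⊚)` and OUR stand-in carrier; typed ≠ proved-in-print; no side on [IUTchIII] Cor 3.12; not an abc claim.
([IUTchI] Cor 5.3 (i) p.144) [cite: MochizukiFrdI2008, Cor. 4.11 (ii) p.91] [cite: NeukirchSchmidtWingberg2008, Thm (12.2.1)]
[claim: Mochizuki2012, status: disputed] -/
theorem arith_descendBijective :
    CatIsomorphism.DescendBijective (GlobalDivisorData.arith F).modelBase (GlobalDivisorData.arith F).modelBase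
      (GlobalDivisorData.hasUnder_modelBase_arith F F) (GlobalDivisorData.underUnique_modelBase_arith F F) :=
  arith_descendBijective_of_neukirchUchida F (neukirchUchida_holds F)

end Cor53

/-! ### §2. `⊚` at EVERY open-embedding push carrier `ℬ(H)⁰ → CosetCat H → CosetCat G_F → ℬ(G_F)⁰`: FACT ∅ · LAW ∅ · SIDE ∅ -/

section OpenEmbedding

variable (F : Type) [Field F] [NumberField F]

/-- **`hlift⊚` at EVERY open-embedding push carrier `ι : H ↪ G_F` (`H` profinite; `ι` continuous, open, injective), for EVERY record,
UNCONDITIONAL** — abc-iut-L5-t11's ★ `GlobalFrobenioid.liftsAll_fcircBase_arith_of_openEmbedding_of_neukirchUchida` (p562181: direct lift along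
the Neukirch–Uchida `τ` acting on the whiskered arithmetic divisor data; no descent law, no normality) with FACT {NU} discharged by ★
`neukirchUchida_holds` (abc-iut-L4-d2 p458975): the (k2) binder `hlift` of ★ `Cor53TelescopeCensusKnit` with NO hypothesis beyond the carrier data.
OUR stand-in carriers; no side on [IUTchIII] Cor 3.12; not an abc claim. ([IUTchI] Cor 5.3 (i) p.144) [cite: MochizukiFrdI2008, Ex. 6.3 p.113]
[cite: NeukirchSchmidtWingberg2008, Thm (12.2.1)] [claim: Mochizuki2012, status: disputed] -/
theorem GlobalFrobenioid.liftsAll_fcircBase_arith_of_openEmbedding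
    (H : ProfiniteGrp.{0}) (ι : H →* GalFbar F) (hc : Continuous ι) (ho : IsOpenMap ι) (hinj : Injective ι)
    (𝓕 : GlobalFrobenioid (GlobalDivisorData.arith F) (BaseCat H)
      (baseToCoset H ⋙ CosetCat.push ι ho ⋙ cosetToBase (absGalGrp F))) :
    ∀ Θ : BaseCat H ≌ BaseCat H, ∃ Ψ : 𝓕.Fcirc ≌ 𝓕.Fcirc,
      Nonempty (CatIsomorphism.LiesUnder 𝓕.fcircBase 𝓕.fcircBase Ψ Θ) :=
  GlobalFrobenioid.liftsAll_fcircBase_arith_of_openEmbedding_of_neukirchUchida F (neukirchUchida_holds F) H ι hc ho hinj 𝓕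

/-- **[IUTchI] Cor 5.3 (i) «resp. `⊚`» AS PRINTED («bijective») at the push carrier of EVERY OPEN EMBEDDING `ι : H ↪ G_F`** (the class of
print's `π₁(†𝒟^⊚) ↪ π₁(†𝒟^⊛)`, Ex 5.1 (i)), for EVERY record `𝓕` — displayed binders = the carrier data `{hc, ho, hinj}` ONLY: **FACT ∅ · LAW ∅ ·
SIDE ∅** (injectivity ★ `Cor53.fcirc_rigidOverBase_of_pushCarrier` from the slimness of `G_F`; surjectivity the preceding lift): abc-iut-L5-t11's
★ `Cor53.fcirc_descendBijective_of_openEmbedding_of_neukirchUchida_sideFree` (p562181) with FACT {NU} discharged by ★ `neukirchUchida_holds`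
(abc-iut-L4-d2 p458975).  OUR stand-in carrier and OUR routes; typed ≠ inhabited ≠ proved-in-print (the record type is inhabited: ★
`nonempty_globalFrobenioid`); no side on [IUTchIII] Cor 3.12; not an abc claim. ([IUTchI] Cor 5.3 (i) p.144)
[cite: NeukirchSchmidtWingberg2008, Thm (12.2.1)] [cite: MochizukiFrdI2008, Prop. 1.6 p.27] [claim: Mochizuki2012, status: disputed] -/
theorem Cor53.fcirc_descendBijective_of_openEmbedding
    (H : ProfiniteGrp.{0}) (ι : H →* GalFbar F) (hc : Continuous ι) (ho : IsOpenMap ι) (hinj : Injective ι)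
    (𝓕 : GlobalFrobenioid (GlobalDivisorData.arith F) (BaseCat H)
      (baseToCoset H ⋙ CosetCat.push ι ho ⋙ cosetToBase (absGalGrp F))) :
    CatIsomorphism.DescendBijective 𝓕.fcircBase 𝓕.fcircBase
      (GlobalFrobenioid.hasUnder_and_underUnique_fcircBase_arith_baseCat 𝓕 𝓕
        (isSlimGroup_of_injective_of_isOpenMap ι ho hinj (isSlimGroup_absGalGrp F))
        (isSlimGroup_of_injective_of_isOpenMap ι ho hinj (isSlimGroup_absGalGrp F))).1
      (GlobalFrobenioid.hasUnder_and_underUnique_fcircBase_arith_baseCat 𝓕 𝓕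
        (isSlimGroup_of_injective_of_isOpenMap ι ho hinj (isSlimGroup_absGalGrp F))
        (isSlimGroup_of_injective_of_isOpenMap ι ho hinj (isSlimGroup_absGalGrp F))).2 :=
  Cor53.fcirc_descendBijective_of_openEmbedding_of_neukirchUchida_sideFree F (neukirchUchida_holds F) H ι hc ho hinj 𝓕

end OpenEmbedding

/-! ### §3. The descent-route law at the `G_F` stand-in is EXACTLY normality — UNCONDITIONAL `iff` -/

section DescentLaw

variable (F : Type) [Field F] [NumberField F]

/-- **`hdesc⊚` at EVERY open-embedding carrier (every record over the arithmetic divisor data) `⟺ F/ℚ` normal — UNCONDITIONAL `iff`**: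
abc-iut-L5-t4's ★ `Cor53.forall_openEmbedding_hdesc_iff_normal_of_neukirchUchida` (p559943: `⟹` from the slimness of `Aut_ℚ(F̄)`, `⟸` through
`AutCompatible ι`) with FACT {NU} discharged by ★ `neukirchUchida_holds` (abc-iut-L4-d2 p458975).  So at OUR `G_F` stand-in the DESCENT route to
«`⊚` bijective» carries exactly the side {`Normal ℚ F`}, while the LIFT route (§2) carries nothing.  OUR stand-in carriers; no side on [IUTchIII]
Cor 3.12; not an abc claim. ([IUTchI] Cor 5.3 (i) p.144) [cite: MochizukiAbsAnab2004, Thm 1.1.1 (ii) p.6]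
[cite: NeukirchSchmidtWingberg2008, Thm (12.2.1)] [claim: Mochizuki2012, status: disputed] -/
theorem Cor53.forall_openEmbedding_hdesc_iff_normal :
    (∀ (H : ProfiniteGrp.{0}) (ι : H →* GalFbar F) (_ : Continuous ι) (ho : IsOpenMap ι) (_ : Injective ι)
      (𝓕 : GlobalFrobenioid (GlobalDivisorData.arith F) (BaseCat H)
        (baseToCoset H ⋙ CosetCat.push ι ho ⋙ cosetToBase (absGalGrp F))),
      ∀ Θ : BaseCat H ≌ BaseCat H, ∃ ΘB : 𝓕.Base ≌ 𝓕.Base, Nonempty (Θ.functor ⋙ 𝓕.baseMor ≅ 𝓕.baseMor ⋙ ΘB.functor)) ↔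
      Normal ℚ F :=
  Cor53.forall_openEmbedding_hdesc_iff_normal_of_neukirchUchida F (neukirchUchida_holds F)

end DescentLaw

end Literature.IUT.HodgeTheaters

end
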